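import Literature.Topology.FourManifolds.RegularSublevelSet
import Literature.Topology.FourManifolds.RegularLevelSet
import HarnessLib

/-!
# Boundary slice charts: codimension-one submanifolds with boundary of a manifold without
# boundary (Lee 2013, Thm. 5.51)

Topic `Literature/Topology/FourManifolds`; general infrastructure (used by the fact seat
`provefact-Literature.Topology.FourManifolds.exists_isBalancedGKTrisection`, Gay–Kirby 2016,
Thm. 4: the handlebody `H₂₃ = X₂ ∩ X₃` of the trisection built from a handle decomposition is a
compact `3`-dimensional submanifold of the closed `4`-manifold *with boundary* the central
surface `F`).  Everything in this file is **proved**; no named facts are introduced.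

Lee, *Introduction to Smooth Manifolds* (2013), Ch. 5, "Submanifolds with boundary" and
Thm. 5.51: a subset `S` of a smooth manifold `M` without boundary which satisfies the *local
`k`-slice condition for submanifolds with boundary* — every point of `S` lies in a chart of `M`
in which `S` is a `k`-dimensional slice or **half-slice**
`{x^{k+1} = ⋯ = xⁿ = 0, x^k ≥ 0}` ("boundary slice chart") — is, with the subspace topology and
the charts obtained by dropping the vanishing coordinates, an embedded `k`-dimensional
submanifold with boundary.  Here in codimension one, for `M` modelled on `ℝᵏ⁺²` (chart space
the vector space itself, `𝓡 (k + 2)`), with the slice coordinate the *last* one (as in the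
tree's `SliceCharts.lean`) and the half-space coordinate the `0`-th one (as Mathlib's model
`𝓡∂ (k + 1)` wants):

* `BoundarySliceChart S` — an `ℝᵏ⁺²`-valued local diffeomorphism `Θ` of `M` (smooth with smooth
  inverse) with `q ∈ S ↔ (Θ q)_{k+1} = 0 ∧ 0 ≤ (Θ q)₀` on its source (interior slice charts are
  the ones with `(Θ q)₀ > 0` throughout); `D.chart p : OpenPartialHomeomorph S (ℍᵏ⁺¹)` the
  induced chart of `S` (drop the last coordinate); `contDiffOn_symm_trans`: any two induced
  charts are `C^∞`-compatible; constructors `restrOpen`, `ofInteriorSlice` (from a chart of the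
  maximal atlas in which `S` is the slice `{last = 0}`: translate the `0`-th coordinate to make
  it positive near the point);
* `BoundarySliceAtlas S` (a boundary slice chart at every point of `S`) and, for
  `Φ : BoundarySliceAtlas S`: `Φ.chartedSpace : ChartedSpace (ℍᵏ⁺¹) S` (atlas: the charts
  induced by *all* boundary slice charts), `Φ.isManifold : IsManifold (𝓡∂ (k + 1)) ∞ S`,
  `Φ.isBoundaryPoint_iff` (`↔ (Θₚ p)₀ = 0`), `Φ.isInteriorPoint_iff`;
* `Φ.isImmersion_subtype_val`, `Φ.isSmoothEmbedding_subtype_val`, `Φ.contMDiff_subtype_val`: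
  the inclusion `S → M` is a smooth embedding — in the charts `D.chart p` of `S` and `D.Θ` of
  `M` it reads `u ↦ snocEquiv (u, 0)`, Mathlib's normal form
  `Manifold.IsImmersionAtOfComplement` with complement `ℝ`.

The construction combines the tree's `HalfSliceChart` (`RegularSublevelSet.lean`: regular
domains, the half-space coordinate) and `SliceChartFamily` (`SliceCharts.lean`: slices, the
last coordinate dropped with `snocEquiv`).

## References

* J. M. Lee, *Introduction to Smooth Manifolds*, 2nd ed., GTM 218, Springer (2013), Ch. 5,
  "Submanifolds with boundary", Thm. 5.51 (PDF p. 151 of the held copy). [LeeSmoothManifolds2013]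
-/

open scoped Manifold ContDiff Topology
open Set Function

noncomputable section

universe u

namespace Literature.Topology.FourManifolds

/-- Local notation: `𝔼 n` is the model Euclidean space `EuclideanSpace ℝ (Fin n)`. -/
local notation "𝔼 " n:arg => EuclideanSpace ℝ (Fin n)
/-- Local notation: `ℍ n` is the model half-space `EuclideanHalfSpace n`. -/
local notation "ℍ " n:arg => EuclideanHalfSpace n

section Drop

variable (k : ℕ)

/-- Dropping the last coordinate of `ℝᵏ⁺²`, as a continuous linear map onto `ℝᵏ⁺¹` (the first
component of `snocEquiv⁻¹`). [folklore] -/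
def dropLast : (𝔼 (k + 2)) →L[ℝ] 𝔼 (k + 1) :=
  (ContinuousLinearMap.fst ℝ (𝔼 (k + 1)) ℝ).comp (snocEquiv (k + 1)).symm.toContinuousLinearMap

/-- `dropLast` is the first component of `snocEquiv⁻¹` (definitional). [folklore] -/
theorem dropLast_apply (y : 𝔼 (k + 2)) : dropLast k y = ((snocEquiv (k + 1)).symm y).1 := rfl

/-- The coordinates of `dropLast y`. [folklore] -/
theorem dropLast_apply_coord (y : 𝔼 (k + 2)) (i : Fin (k + 1)) : dropLast k y i = y (Fin.castSucc i) := by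
  rw [dropLast_apply, snocEquiv_symm_apply_fst]

/-- The `0`-th coordinate is kept. [folklore] -/
theorem dropLast_apply_zero (y : 𝔼 (k + 2)) : dropLast k y 0 = y 0 := by
  rw [dropLast_apply_coord]; rfl

/-- `dropLast (snocEquiv (u, t)) = u`. [folklore] -/
theorem dropLast_snocEquiv (u : 𝔼 (k + 1)) (t : ℝ) : dropLast k (snocEquiv (k + 1) (u, t)) = u := by
  rw [dropLast_apply, snocEquiv_symm_apply_fst_snocEquiv]

/-- A vector with vanishing last coordinate is recovered from `dropLast`. [folklore] -/
theorem snocEquiv_dropLast {y : 𝔼 (k + 2)} (hy : y (Fin.last (k + 1)) = 0) :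
    snocEquiv (k + 1) (dropLast k y, 0) = y := by
  rw [dropLast_apply]; exact snocEquiv_fst_zero_of_apply_last (k + 1) hy

/-- `u ↦ snocEquiv (u, 0)` is continuous on the half-space. [folklore] -/
theorem continuous_snocEquiv_val_zero :
    Continuous fun u : ℍ (k + 1) => snocEquiv (k + 1) (u.val, 0) :=
  (continuous_snocEquiv_zero (k + 1)).comp continuous_subtype_val

end Drop

section BSlice

variable {k : ℕ} {M : Type u} [TopologicalSpace M] [ChartedSpace (𝔼 (k + 2)) M]

/-- A **boundary slice chart** for a subset `S` of a manifold `M` modelled on `ℝᵏ⁺²` (without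
boundary): an `ℝᵏ⁺²`-valued local diffeomorphism `Θ` of `M` (an open partial homeomorphism onto
an open subset of `ℝᵏ⁺²`, smooth with smooth inverse) in which `S` is the half-slice
`{y_{k+1} = 0, 0 ≤ y₀}`: `q ∈ S ↔ (Θ q) (Fin.last (k + 1)) = 0 ∧ 0 ≤ (Θ q) 0` for
`q ∈ Θ.source` (Lee's boundary slice charts; his interior slice charts are the ones with
`(Θ q) 0 > 0` on the source). [cite: LeeSmoothManifolds2013, Thm. 5.51] -/
structure BoundarySliceChart (k : ℕ) {M : Type u} [TopologicalSpace M] [ChartedSpace (𝔼 (k + 2)) M]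
    (S : Set M) where
  /-- The local diffeomorphism of `M` into the model vector space. -/
  Θ : OpenPartialHomeomorph M (𝔼 (k + 2))
  /-- It is smooth on its source. -/
  contMDiffOn_toFun : ContMDiffOn (𝓡 (k + 2)) (𝓡 (k + 2)) ∞ Θ Θ.source
  /-- Its inverse is smooth on its target. -/
  contMDiffOn_symm : ContMDiffOn (𝓡 (k + 2)) (𝓡 (k + 2)) ∞ Θ.symm Θ.target
  /-- In the chart, `S` is the half-slice `{y_{k+1} = 0, 0 ≤ y₀}`. -/
  mem_iff : ∀ q ∈ Θ.source, q ∈ S ↔ Θ q (Fin.last (k + 1)) = 0 ∧ 0 ≤ Θ q 0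

namespace BoundarySliceChart

variable {S : Set M} (D : BoundarySliceChart k S)

/-- Points of `S` have vanishing last coordinate in a boundary slice chart. [folklore] -/
theorem apply_last_eq_zero {q : M} (hq : q ∈ D.Θ.source) (hqS : q ∈ S) : D.Θ q (Fin.last (k + 1)) = 0 :=
  ((D.mem_iff q hq).1 hqS).1

/-- Points of `S` have nonnegative `0`-th coordinate in a boundary slice chart. [folklore] -/
theorem apply_zero_nonneg {q : M} (hq : q ∈ D.Θ.source) (hqS : q ∈ S) : 0 ≤ D.Θ q 0 :=
  ((D.mem_iff q hq).1 hqS).2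

/-- On `S`, the chart is recovered from its first `k + 1` coordinates. [folklore] -/
theorem snocEquiv_dropLast_apply {q : M} (hq : q ∈ D.Θ.source) (hqS : q ∈ S) :
    snocEquiv (k + 1) (dropLast k (D.Θ q), 0) = D.Θ q :=
  snocEquiv_dropLast k (D.apply_last_eq_zero hq hqS)

/-- A boundary slice chart pulls the half-slice back into `S`. [folklore] -/
theorem symm_mem {z : 𝔼 (k + 2)} (hz : z ∈ D.Θ.target) (hzl : z (Fin.last (k + 1)) = 0) (hz0 : 0 ≤ z 0) :
    D.Θ.symm z ∈ S := by
  rw [D.mem_iff _ (D.Θ.map_target hz), D.Θ.right_inv hz]; exact ⟨hzl, hz0⟩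

/-- A boundary slice chart pulls `snocEquiv (u, 0)`, `u` in the half-space, back into `S`. [folklore] -/
theorem symm_snocEquiv_mem {u : 𝔼 (k + 1)} (hu0 : 0 ≤ u 0) (hu : snocEquiv (k + 1) (u, 0) ∈ D.Θ.target) :
    D.Θ.symm (snocEquiv (k + 1) (u, 0)) ∈ S :=
  D.symm_mem hu (snocEquiv_apply_last (k + 1) _) (by rw [snocEquiv_apply_zero]; exact hu0)

/-- The half-space point of `ℍᵏ⁺¹` underlying the first coordinates of a point of `S`. [folklore] -/
theorem modelHalf_symm_dropLast_val {q : M} (hq : q ∈ D.Θ.source) (hqS : q ∈ S) :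
    ((𝓡∂ (k + 1)).symm (dropLast k (D.Θ q))).val = dropLast k (D.Θ q) := by
  have h0 : 0 ≤ dropLast k (D.Θ q) 0 := by rw [dropLast_apply_zero]; exact D.apply_zero_nonneg hq hqS
  have := modelHalf_apply_symm h0
  rwa [modelHalf_apply] at this

open Classical in
/-- The chart of `S`, valued in the half-space `ℍᵏ⁺¹`, induced by a boundary slice chart `D`:
restrict `D.Θ` to `S` and drop the last coordinate (which vanishes on `S`); the inverse is
`u ↦ D.Θ⁻¹ (u, 0)` on the target and the junk value `p` elsewhere (Lee's proof of Thm. 5.51).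
[cite: LeeSmoothManifolds2013, Thm. 5.51] -/
def chart (p : S) : OpenPartialHomeomorph S (ℍ (k + 1)) where
  source := Subtype.val ⁻¹' D.Θ.source
  target := {u | snocEquiv (k + 1) (u.val, 0) ∈ D.Θ.target}
  toFun q := (𝓡∂ (k + 1)).symm (dropLast k (D.Θ q.1))
  invFun u := if h : snocEquiv (k + 1) (u.val, 0) ∈ D.Θ.target then
      ⟨D.Θ.symm (snocEquiv (k + 1) (u.val, 0)), D.symm_snocEquiv_mem u.property h⟩ else p
  map_source' q hq := by
    simp only [mem_preimage] at hq
    show snocEquiv (k + 1) (((𝓡∂ (k + 1)).symm (dropLast k (D.Θ q.1))).val, 0) ∈ D.Θ.target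
    rw [D.modelHalf_symm_dropLast_val hq q.2, D.snocEquiv_dropLast_apply hq q.2]
    exact D.Θ.map_source hq
  map_target' u hu := by
    have hu' : snocEquiv (k + 1) (u.val, 0) ∈ D.Θ.target := hu
    simp only [hu', ↓reduceDIte, mem_preimage]
    exact D.Θ.map_target hu'
  left_inv' q hq := by
    simp only [mem_preimage] at hq
    have h1 : snocEquiv (k + 1) (((𝓡∂ (k + 1)).symm (dropLast k (D.Θ q.1))).val, 0) = D.Θ q.1 := by
      rw [D.modelHalf_symm_dropLast_val hq q.2, D.snocEquiv_dropLast_apply hq q.2]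
    have h2 : snocEquiv (k + 1) (((𝓡∂ (k + 1)).symm (dropLast k (D.Θ q.1))).val, 0) ∈ D.Θ.target := by
      rw [h1]; exact D.Θ.map_source hq
    simp only [h2, ↓reduceDIte]
    ext1
    simp only [h1]
    exact D.Θ.left_inv hq
  right_inv' u hu := by
    have hu' : snocEquiv (k + 1) (u.val, 0) ∈ D.Θ.target := hu
    simp only [hu', ↓reduceDIte]
    rw [D.Θ.right_inv hu', dropLast_snocEquiv]
    exact (𝓡∂ (k + 1)).left_inv u
  open_source := D.Θ.open_source.preimage continuous_subtype_val
  open_target := D.Θ.open_target.preimage (continuous_snocEquiv_val_zero k)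
  continuousOn_toFun :=
    (𝓡∂ (k + 1)).continuous_symm.comp_continuousOn ((dropLast k).continuous.comp_continuousOn
      (D.Θ.continuousOn.comp continuous_subtype_val.continuousOn fun _ hq => hq))
  continuousOn_invFun := by
    rw [Topology.IsInducing.subtypeVal.continuousOn_iff]
    refine ContinuousOn.congr (f := fun u : ℍ (k + 1) => D.Θ.symm (snocEquiv (k + 1) (u.val, 0))) ?_ ?_
    · exact D.Θ.continuousOn_symm.comp (continuous_snocEquiv_val_zero k).continuousOn fun u hu => hu
    · intro u hu
      have hu' : snocEquiv (k + 1) (u.val, 0) ∈ D.Θ.target := hu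
      simp [hu']

/-- The chart of `S` induced by `D`, as a function (definitional). [folklore] -/
theorem chart_apply (p q : S) : D.chart p q = (𝓡∂ (k + 1)).symm (dropLast k (D.Θ q.1)) := rfl

/-- The source of the chart of `S` induced by `D` (definitional). [folklore] -/
@[simp]
theorem chart_source (p : S) : (D.chart p).source = Subtype.val ⁻¹' D.Θ.source := rfl

/-- The target of the chart of `S` induced by `D` (definitional). [folklore] -/
theorem mem_chart_target {p : S} {u : ℍ (k + 1)} :
    u ∈ (D.chart p).target ↔ snocEquiv (k + 1) (u.val, 0) ∈ D.Θ.target := Iff.rfl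

/-- On its source, the chart of `S` read in `ℝᵏ⁺¹` is `dropLast ∘ D.Θ`. [folklore] -/
theorem modelHalf_chart_apply {p q : S} (hq : q ∈ (D.chart p).source) :
    (𝓡∂ (k + 1)) (D.chart p q) = dropLast k (D.Θ q.1) := by
  rw [chart_apply, modelHalf_apply, D.modelHalf_symm_dropLast_val hq q.2]

/-- On its source, `snocEquiv (chart, 0) = D.Θ`. [folklore] -/
theorem snocEquiv_modelHalf_chart_apply {p q : S} (hq : q ∈ (D.chart p).source) :
    snocEquiv (k + 1) ((𝓡∂ (k + 1)) (D.chart p q), 0) = D.Θ q.1 := by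
  rw [D.modelHalf_chart_apply hq, D.snocEquiv_dropLast_apply hq q.2]

/-- On its target, the inverse of the chart of `S` is `u ↦ D.Θ⁻¹ (u, 0)`. [folklore] -/
theorem coe_chart_symm_of_mem {p : S} {u : ℍ (k + 1)} (hu : u ∈ (D.chart p).target) :
    ((D.chart p).symm u).1 = D.Θ.symm (snocEquiv (k + 1) (u.val, 0)) := by
  have hu' : snocEquiv (k + 1) (u.val, 0) ∈ D.Θ.target := hu
  have : (D.chart p).symm u = ⟨D.Θ.symm (snocEquiv (k + 1) (u.val, 0)), D.symm_snocEquiv_mem u.property hu'⟩ :=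
    dif_pos hu'
  rw [this]

/-- On its source, the extended chart of `S` is `dropLast ∘ D.Θ`. [folklore] -/
theorem extend_chart_apply {p q : S} (hq : q ∈ (D.chart p).source) :
    (D.chart p).extend (𝓡∂ (k + 1)) q = dropLast k (D.Θ q.1) := by
  rw [OpenPartialHomeomorph.extend_coe, comp_apply, D.modelHalf_chart_apply hq]

/-- The target of the extended chart of `S` induced by `D`. [folklore] -/
theorem mem_extend_chart_target {p : S} {z : 𝔼 (k + 1)} :
    z ∈ ((D.chart p).extend (𝓡∂ (k + 1))).target ↔ 0 ≤ z 0 ∧ snocEquiv (k + 1) (z, 0) ∈ D.Θ.target := by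
  rw [OpenPartialHomeomorph.extend_target, mem_inter_iff, mem_preimage, mem_chart_target,
    range_modelWithCornersEuclideanHalfSpace]
  constructor
  · rintro ⟨h1, h2⟩
    have h2' : 0 ≤ z 0 := h2
    refine ⟨h2', ?_⟩
    have h3 : ((𝓡∂ (k + 1)).symm z).val = z := by
      have := modelHalf_apply_symm h2'; rwa [modelHalf_apply] at this
    rwa [h3] at h1
  · rintro ⟨h1, h2⟩
    have h3 : ((𝓡∂ (k + 1)).symm z).val = z := by
      have := modelHalf_apply_symm h1; rwa [modelHalf_apply] at this
    refine ⟨?_, h1⟩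
    show snocEquiv (k + 1) (((𝓡∂ (k + 1)).symm z).val, 0) ∈ D.Θ.target
    rwa [h3]

/-- On its target, the inverse of the extended chart of `S` is `z ↦ D.Θ⁻¹ (z, 0)`. [folklore] -/
theorem coe_extend_chart_symm_of_mem {p : S} {z : 𝔼 (k + 1)} (hz0 : 0 ≤ z 0)
    (hz : snocEquiv (k + 1) (z, 0) ∈ D.Θ.target) :
    (((D.chart p).extend (𝓡∂ (k + 1))).symm z).1 = D.Θ.symm (snocEquiv (k + 1) (z, 0)) := by
  have h3 : ((𝓡∂ (k + 1)).symm z).val = z := by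
    have := modelHalf_apply_symm hz0; rwa [modelHalf_apply] at this
  rw [OpenPartialHomeomorph.extend_coe_symm, comp_apply, D.coe_chart_symm_of_mem, h3]
  show snocEquiv (k + 1) (((𝓡∂ (k + 1)).symm z).val, 0) ∈ D.Θ.target
  rwa [h3]

/-- **Compatibility of boundary slice charts**: for two boundary slice charts `D`, `D'` of `S`,
the transition map between the induced charts of `S`, read in `ℝᵏ⁺¹` through `𝓡∂ (k + 1)`, is
`z ↦ dropLast (D'.Θ (D.Θ⁻¹ (z, 0)))` on the relevant part of the half-space, hence smooth.
[cite: LeeSmoothManifolds2013, Thm. 5.51] -/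
theorem contDiffOn_symm_trans (D D' : BoundarySliceChart k S) (p p' : S) :
    ContDiffOn ℝ ∞ ((𝓡∂ (k + 1)) ∘ ((D.chart p).symm ≫ₕ D'.chart p') ∘ (𝓡∂ (k + 1)).symm)
      ((𝓡∂ (k + 1)).symm ⁻¹' ((D.chart p).symm ≫ₕ D'.chart p').source ∩ range (𝓡∂ (k + 1))) := by
  have key0 : ContDiffOn ℝ ∞ (D'.Θ ∘ D.Θ.symm) (D.Θ.target ∩ D.Θ.symm ⁻¹' D'.Θ.source) := by
    rw [← contMDiffOn_iff_contDiffOn]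
    exact D'.contMDiffOn_toFun.comp (D.contMDiffOn_symm.mono inter_subset_left) fun z hz => hz.2
  have key : ContDiffOn ℝ ∞ (fun z : 𝔼 (k + 1) => dropLast k (D'.Θ (D.Θ.symm (snocEquiv (k + 1) (z, 0)))))
      {z | snocEquiv (k + 1) (z, 0) ∈ D.Θ.target ∧ D.Θ.symm (snocEquiv (k + 1) (z, 0)) ∈ D'.Θ.source} :=
    (dropLast k).contDiff.comp_contDiffOn (key0.comp (contDiff_snocEquiv_zero (k + 1)).contDiffOn
      fun z hz => ⟨hz.1, hz.2⟩)
  have hmem : ∀ z ∈ (𝓡∂ (k + 1)).symm ⁻¹' ((D.chart p).symm ≫ₕ D'.chart p').source ∩ range (𝓡∂ (k + 1)),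
      0 ≤ z 0 ∧ snocEquiv (k + 1) (z, 0) ∈ D.Θ.target ∧ D.Θ.symm (snocEquiv (k + 1) (z, 0)) ∈ D'.Θ.source := by
    rintro z ⟨hz, hzr⟩
    rw [range_modelWithCornersEuclideanHalfSpace] at hzr
    have hz0 : 0 ≤ z 0 := hzr
    have h3 : ((𝓡∂ (k + 1)).symm z).val = z := by
      have := modelHalf_apply_symm hz0; rwa [modelHalf_apply] at this
    simp only [mem_preimage, OpenPartialHomeomorph.trans_source, OpenPartialHomeomorph.symm_source,
      mem_inter_iff, mem_chart_target, h3, chart_source] at hz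
    refine ⟨hz0, hz.1, ?_⟩
    have htgt : (𝓡∂ (k + 1)).symm z ∈ (D.chart p).target := by
      rw [mem_chart_target, h3]; exact hz.1
    have := hz.2
    rwa [D.coe_chart_symm_of_mem htgt, h3] at this
  refine (key.mono fun z hz => (hmem z hz).2).congr fun z hz => ?_
  obtain ⟨hz0, hzt, hzs⟩ := hmem z hz
  have h3 : ((𝓡∂ (k + 1)).symm z).val = z := by
    have := modelHalf_apply_symm hz0; rwa [modelHalf_apply] at this
  have htgt : (𝓡∂ (k + 1)).symm z ∈ (D.chart p).target := by
    rw [mem_chart_target, h3]; exact hzt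
  have hsrc : (D.chart p).symm ((𝓡∂ (k + 1)).symm z) ∈ (D'.chart p').source := by
    show ((D.chart p).symm ((𝓡∂ (k + 1)).symm z)).1 ∈ D'.Θ.source
    rw [D.coe_chart_symm_of_mem htgt, h3]; exact hzs
  simp only [comp_apply, OpenPartialHomeomorph.coe_trans]
  rw [D'.modelHalf_chart_apply hsrc, D.coe_chart_symm_of_mem htgt, h3]

/-- Restricting a boundary slice chart to an open set. [folklore] -/
def restrOpen (U : Set M) (hU : IsOpen U) : BoundarySliceChart k S where
  Θ := D.Θ.restrOpen U hU
  contMDiffOn_toFun := D.contMDiffOn_toFun.mono inter_subset_left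
  contMDiffOn_symm := D.contMDiffOn_symm.mono (by
    rw [OpenPartialHomeomorph.restrOpen_toPartialEquiv, PartialEquiv.restr_target]
    exact inter_subset_left)
  mem_iff q hq := D.mem_iff q hq.1

/-- The underlying partial homeomorphism of a restricted chart (definitional). [folklore] -/
@[simp]
theorem restrOpen_Θ (U : Set M) (hU : IsOpen U) : (D.restrOpen U hU).Θ = D.Θ.restrOpen U hU := rfl

end BoundarySliceChart

/-! ### Boundary slice atlases -/

/-- A **boundary slice atlas** for `S ⊆ M`: a boundary slice chart around every point of `S`
(Lee's local slice condition for submanifolds with boundary, codimension one).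
[cite: LeeSmoothManifolds2013, Thm. 5.51] -/
structure BoundarySliceAtlas (k : ℕ) {M : Type u} [TopologicalSpace M] [ChartedSpace (𝔼 (k + 2)) M]
    (S : Set M) where
  /-- The boundary slice chart at `p ∈ S`. -/
  datum : S → BoundarySliceChart k S
  /-- `p` lies in the source of its chart. -/
  mem_source : ∀ p, p.1 ∈ (datum p).Θ.source

namespace BoundarySliceAtlas

variable {S : Set M} (Φ : BoundarySliceAtlas k S)

/-- **The manifold-with-boundary structure on a half-slice subset, charts**: the atlas of `S`
consists of the charts of `S` induced by *all* boundary slice charts of `S`; the preferred chart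
at `p` is the one induced by `Φ.datum p`.  A `def`, not an instance: it depends on `Φ`.
[cite: LeeSmoothManifolds2013, Thm. 5.51] -/
@[reducible]
def chartedSpace : ChartedSpace (ℍ (k + 1)) S where
  atlas := {e | ∃ (D : BoundarySliceChart k S) (p : S), D.chart p = e}
  chartAt p := (Φ.datum p).chart p
  mem_chart_source p := Φ.mem_source p
  chart_mem_atlas p := ⟨Φ.datum p, p, rfl⟩

/-- The preferred chart of `Φ.chartedSpace` at `p` (definitional). [folklore] -/
theorem chartAt_eq (p : S) : letI := Φ.chartedSpace; chartAt (H := ℍ (k + 1)) p = (Φ.datum p).chart p :=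
  rfl

/-- Every boundary slice chart induces a member of the atlas `Φ.chartedSpace`. [folklore] -/
theorem chart_mem_atlas (D : BoundarySliceChart k S) (q : S) :
    letI := Φ.chartedSpace; D.chart q ∈ atlas (H := ℍ (k + 1)) (M := S) :=
  ⟨D, q, rfl⟩

/-- **The manifold-with-boundary structure on a half-slice subset, compatibility**: the charts
induced by boundary slice charts form a `C^∞` atlas modelled on `𝓡∂ (k + 1)`.
[cite: LeeSmoothManifolds2013, Thm. 5.51] -/
theorem isManifold : letI := Φ.chartedSpace; IsManifold (𝓡∂ (k + 1)) ∞ S := by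
  letI := Φ.chartedSpace
  apply isManifold_of_contDiffOn
  rintro e e' ⟨D, p, rfl⟩ ⟨D', p', rfl⟩
  exact D.contDiffOn_symm_trans D' p p'

/-- The extended preferred chart at `p`, evaluated at `p`. [folklore] -/
theorem extChartAt_self_apply (p : S) :
    letI := Φ.chartedSpace; extChartAt (𝓡∂ (k + 1)) p p = dropLast k ((Φ.datum p).Θ p.1) := by
  letI := Φ.chartedSpace
  exact (Φ.datum p).extend_chart_apply (Φ.mem_source p)

/-- **Boundary points of a half-slice subset**: `p ∈ S` is a boundary point of `S` iff its
`0`-th coordinate in the boundary slice chart at `p` vanishes. [cite: LeeSmoothManifolds2013, Thm. 5.51] -/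
theorem isBoundaryPoint_iff (p : S) :
    letI := Φ.chartedSpace; (𝓡∂ (k + 1)).IsBoundaryPoint p ↔ (Φ.datum p).Θ p.1 0 = 0 := by
  letI := Φ.chartedSpace
  rw [ModelWithCorners.IsBoundaryPoint, extChartAt_self_apply,
    frontier_range_modelWithCornersEuclideanHalfSpace, mem_setOf_eq, dropLast_apply_zero]
  exact ⟨fun h => Eq.symm h, fun h => Eq.symm h⟩

/-- **Interior points of a half-slice subset**: `p ∈ S` is an interior point of `S` iff its
`0`-th coordinate in the boundary slice chart at `p` is positive. [cite: LeeSmoothManifolds2013, Thm. 5.51] -/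
theorem isInteriorPoint_iff (p : S) :
    letI := Φ.chartedSpace; (𝓡∂ (k + 1)).IsInteriorPoint p ↔ 0 < (Φ.datum p).Θ p.1 0 := by
  letI := Φ.chartedSpace
  rw [ModelWithCorners.IsInteriorPoint, extChartAt_self_apply,
    interior_range_modelWithCornersEuclideanHalfSpace, mem_setOf_eq, dropLast_apply_zero]

end BoundarySliceAtlas

/-! ### The inclusion is a smooth embedding -/

section Embedding

variable [IsManifold (𝓡 (k + 2)) ∞ M] {S : Set M}

/-- The local diffeomorphism of a boundary slice chart is a chart of the maximal atlas of `M`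
(local diffeomorphisms into the model space are compatible charts). [folklore] -/
theorem BoundarySliceChart.Θ_mem_maximalAtlas (D : BoundarySliceChart k S) :
    D.Θ ∈ IsManifold.maximalAtlas (𝓡 (k + 2)) ∞ M :=
  D.Θ.mem_maximalAtlas_of_contMDiffOn D.contMDiffOn_toFun D.contMDiffOn_symm

namespace BoundarySliceAtlas

variable (Φ : BoundarySliceAtlas k S)

/-- **The inclusion of a half-slice subset is a smooth immersion**: in the chart of `S` induced
by the boundary slice chart `Θ` at `p` and the chart `Θ` of `M`, the inclusion `S → M` reads
`u ↦ snocEquiv (u, 0)`, Mathlib's normal form `Manifold.IsImmersionAtOfComplement` with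
complement `ℝ`. [cite: LeeSmoothManifolds2013, Thm. 5.51] -/
theorem isImmersion_subtype_val :
    letI := Φ.chartedSpace
    Manifold.IsImmersion (𝓡∂ (k + 1)) (𝓡 (k + 2)) ∞ (Subtype.val : S → M) := by
  letI := Φ.chartedSpace
  haveI := Φ.isManifold
  refine Manifold.IsImmersionOfComplement.isImmersion (F := ℝ) fun p => ?_
  set D := Φ.datum p with hD
  refine Manifold.IsImmersionAtOfComplement.mk_of_continuousAt
    continuous_subtype_val.continuousAt (snocEquiv (k + 1)) (D.chart p) D.Θ
    (Φ.mem_source p) (Φ.mem_source p)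
    (IsManifold.subset_maximalAtlas (Φ.chart_mem_atlas D p)) D.Θ_mem_maximalAtlas ?_
  intro z hz
  rw [BoundarySliceChart.mem_extend_chart_target] at hz
  obtain ⟨hz0, hzt⟩ := hz
  simp only [comp_apply, OpenPartialHomeomorph.extend_coe, modelWithCornersSelf_coe, id_eq]
  rw [D.coe_extend_chart_symm_of_mem hz0 hzt, D.Θ.right_inv hzt]

/-- **The inclusion of a half-slice subset is a smooth embedding**: a smooth immersion and a
topological embedding. [cite: LeeSmoothManifolds2013, Thm. 5.51] -/
theorem isSmoothEmbedding_subtype_val :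
    letI := Φ.chartedSpace
    Manifold.IsSmoothEmbedding (𝓡∂ (k + 1)) (𝓡 (k + 2)) ∞ (Subtype.val : S → M) := by
  letI := Φ.chartedSpace
  exact ⟨Φ.isImmersion_subtype_val, Topology.IsEmbedding.subtypeVal⟩

/-- The inclusion of a half-slice subset is smooth. [cite: LeeSmoothManifolds2013, Thm. 5.51] -/
theorem contMDiff_subtype_val :
    letI := Φ.chartedSpace
    ContMDiff (𝓡∂ (k + 1)) (𝓡 (k + 2)) ∞ (Subtype.val : S → M) := by
  letI := Φ.chartedSpace
  exact Φ.isImmersion_subtype_val.contMDiff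

omit [IsManifold (𝓡 (k + 2)) ∞ M] in
/-- **The boundary of a half-slice subset** is the set of points whose `0`-th coordinate in
their boundary slice chart vanishes. [cite: LeeSmoothManifolds2013, Thm. 5.51] -/
theorem image_boundary_eq :
    letI := Φ.chartedSpace
    Subtype.val '' (𝓡∂ (k + 1)).boundary S = {x | ∃ h : x ∈ S, (Φ.datum ⟨x, h⟩).Θ x 0 = 0} := by
  letI := Φ.chartedSpace
  ext x
  simp only [mem_image, mem_setOf_eq]
  constructor
  · rintro ⟨p, hp, rfl⟩
    exact ⟨p.2, (Φ.isBoundaryPoint_iff p).1 hp⟩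
  · rintro ⟨h, h0⟩
    exact ⟨⟨x, h⟩, (Φ.isBoundaryPoint_iff ⟨x, h⟩).2 h0, rfl⟩

end BoundarySliceAtlas

end Embedding

/-! ### Interior slice charts from charts of the maximal atlas -/

section OfSlice

variable {S : Set M}

/-- The chart `ψ` with its `0`-th coordinate translated by `c`, restricted to where the
translated coordinate is positive. [folklore] -/
def shiftChart (ψ : OpenPartialHomeomorph M (𝔼 (k + 2))) (c : ℝ) : OpenPartialHomeomorph M (𝔼 (k + 2)) where
  toFun q := ψ q + EuclideanSpace.single 0 c
  invFun y := ψ.symm (y - EuclideanSpace.single 0 c)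
  source := ψ.source ∩ (fun q => ψ q 0 + c) ⁻¹' Ioi 0
  target := {y | y - EuclideanSpace.single 0 c ∈ ψ.target ∧ 0 < y 0}
  map_source' q hq := by
    refine ⟨by rw [add_sub_cancel_right]; exact ψ.map_source hq.1, ?_⟩
    show 0 < (ψ q + EuclideanSpace.single 0 c : 𝔼 (k + 2)) 0
    rw [PiLp.add_apply, PiLp.single_apply, if_pos rfl]; exact hq.2
  map_target' y hy := by
    refine ⟨ψ.map_target hy.1, ?_⟩
    show 0 < ψ (ψ.symm (y - EuclideanSpace.single 0 c)) 0 + c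
    rw [ψ.right_inv hy.1, PiLp.sub_apply, PiLp.single_apply, if_pos rfl, sub_add_cancel]
    exact hy.2
  left_inv' q hq := by
    show ψ.symm (ψ q + EuclideanSpace.single 0 c - EuclideanSpace.single 0 c) = q
    rw [add_sub_cancel_right, ψ.left_inv hq.1]
  right_inv' y hy := by
    show ψ (ψ.symm (y - EuclideanSpace.single 0 c)) + EuclideanSpace.single 0 c = y
    rw [ψ.right_inv hy.1, sub_add_cancel]
  open_source :=
    (((EuclideanSpace.proj (0 : Fin (k + 2))).continuous.comp_continuousOn ψ.continuousOn).add
      continuousOn_const).isOpen_inter_preimage ψ.open_source isOpen_Ioi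
  open_target := by
    have h1 : IsOpen {y : 𝔼 (k + 2) | y - EuclideanSpace.single 0 c ∈ ψ.target} :=
      ψ.open_target.preimage (continuous_id.sub continuous_const)
    exact h1.inter (isOpen_lt continuous_const (EuclideanSpace.proj (0 : Fin (k + 2))).continuous)
  continuousOn_toFun := (ψ.continuousOn.mono inter_subset_left).add continuousOn_const
  continuousOn_invFun := ψ.continuousOn_symm.comp (continuous_id.sub continuous_const).continuousOn
    fun y hy => hy.1

omit [ChartedSpace (𝔼 (k + 2)) M] in
/-- The shifted chart, as a function (definitional). [folklore] -/
theorem shiftChart_apply (ψ : OpenPartialHomeomorph M (𝔼 (k + 2))) (c : ℝ) (q : M) :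
    shiftChart ψ c q = ψ q + EuclideanSpace.single 0 c := rfl

omit [ChartedSpace (𝔼 (k + 2)) M] in
/-- The coordinates of the shifted chart. [folklore] -/
theorem shiftChart_apply_coord (ψ : OpenPartialHomeomorph M (𝔼 (k + 2))) (c : ℝ) (q : M) (i : Fin (k + 2)) :
    shiftChart ψ c q i = ψ q i + if i = 0 then c else 0 := by
  rw [shiftChart_apply, PiLp.add_apply, PiLp.single_apply]

omit [ChartedSpace (𝔼 (k + 2)) M] in
/-- The source of the shifted chart (definitional). [folklore] -/
theorem mem_shiftChart_source {ψ : OpenPartialHomeomorph M (𝔼 (k + 2))} {c : ℝ} {q : M} :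
    q ∈ (shiftChart ψ c).source ↔ q ∈ ψ.source ∧ 0 < ψ q 0 + c := Iff.rfl

/-- **An interior slice chart is a boundary slice chart**: if `ψ` is a chart of the maximal
atlas of `M` in which `S` is the slice `{last coordinate = 0}`, then translating its `0`-th
coordinate by `1 - (ψ p)₀` and restricting to where the translated coordinate is positive gives
a boundary slice chart (about `p`) in which the `0`-th coordinate is positive.
[cite: LeeSmoothManifolds2013, Thm. 5.51] -/
def BoundarySliceChart.ofInteriorSlice (ψ : OpenPartialHomeomorph M (𝔼 (k + 2)))
    (hψ : ψ ∈ IsManifold.maximalAtlas (𝓡 (k + 2)) ∞ M) (p : M)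
    (hmem : ∀ q ∈ ψ.source, q ∈ S ↔ ψ q (Fin.last (k + 1)) = 0) : BoundarySliceChart k S where
  Θ := shiftChart ψ (1 - ψ p 0)
  contMDiffOn_toFun := ((contMDiffOn_of_mem_maximalAtlas hψ).mono inter_subset_left).add contMDiffOn_const
  contMDiffOn_symm := (contMDiffOn_symm_of_mem_maximalAtlas hψ).comp
    ((contMDiff_id.sub contMDiff_const).contMDiffOn) fun y hy => hy.1
  mem_iff q hq := by
    rw [hmem q hq.1]
    show _ ↔ shiftChart ψ (1 - ψ p 0) q (Fin.last (k + 1)) = 0 ∧ 0 ≤ shiftChart ψ (1 - ψ p 0) q 0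
    rw [shiftChart_apply_coord, shiftChart_apply_coord, if_neg (Fin.ne_of_gt Fin.last_pos), if_pos rfl,
      add_zero]
    exact ⟨fun h => ⟨h, (mem_shiftChart_source.1 hq).2.le⟩, fun h => h.1⟩

/-- `p` lies in the source of `ofInteriorSlice ψ hψ p hmem` as soon as it lies in `ψ.source`. [folklore] -/
theorem BoundarySliceChart.mem_ofInteriorSlice_source {ψ : OpenPartialHomeomorph M (𝔼 (k + 2))}
    (hψ : ψ ∈ IsManifold.maximalAtlas (𝓡 (k + 2)) ∞ M) {p : M}
    (hmem : ∀ q ∈ ψ.source, q ∈ S ↔ ψ q (Fin.last (k + 1)) = 0) (hp : p ∈ ψ.source) :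
    p ∈ (BoundarySliceChart.ofInteriorSlice ψ hψ p hmem).Θ.source :=
  ⟨hp, by show 0 < ψ p 0 + (1 - ψ p 0); linarith⟩

/-- The source of `ofInteriorSlice ψ hψ p hmem` lies in `ψ.source`. [folklore] -/
theorem BoundarySliceChart.ofInteriorSlice_source_subset {ψ : OpenPartialHomeomorph M (𝔼 (k + 2))}
    (hψ : ψ ∈ IsManifold.maximalAtlas (𝓡 (k + 2)) ∞ M) {p : M}
    (hmem : ∀ q ∈ ψ.source, q ∈ S ↔ ψ q (Fin.last (k + 1)) = 0) :
    (BoundarySliceChart.ofInteriorSlice ψ hψ p hmem).Θ.source ⊆ ψ.source := fun _ hq => hq.1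

/-- In `ofInteriorSlice`, the `0`-th coordinate is positive on the source. [folklore] -/
theorem BoundarySliceChart.ofInteriorSlice_apply_zero_pos {ψ : OpenPartialHomeomorph M (𝔼 (k + 2))}
    (hψ : ψ ∈ IsManifold.maximalAtlas (𝓡 (k + 2)) ∞ M) {p : M}
    (hmem : ∀ q ∈ ψ.source, q ∈ S ↔ ψ q (Fin.last (k + 1)) = 0) {q : M}
    (hq : q ∈ (BoundarySliceChart.ofInteriorSlice ψ hψ p hmem).Θ.source) :
    0 < (BoundarySliceChart.ofInteriorSlice ψ hψ p hmem).Θ q 0 := by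
  show 0 < shiftChart ψ (1 - ψ p 0) q 0
  rw [shiftChart_apply_coord, if_pos rfl]
  exact (mem_shiftChart_source.1 hq).2

end OfSlice

/-! ### Constructors: post-composing with a linear automorphism; interior charts from regular functions -/

section Constructors

variable {S : Set M}

/-- The linear automorphism of `ℝⁿ` permuting the coordinates by `σ`: `(permCoords σ y) i =
y (σ⁻¹ i)`. [folklore] -/
def permCoords {n : ℕ} (σ : Equiv.Perm (Fin n)) : (𝔼 n) ≃L[ℝ] 𝔼 n :=
  (LinearIsometryEquiv.piLpCongrLeft 2 ℝ ℝ σ).toContinuousLinearEquiv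

/-- The coordinates of a permuted vector. [folklore] -/
@[simp]
theorem permCoords_apply {n : ℕ} (σ : Equiv.Perm (Fin n)) (y : 𝔼 n) (i : Fin n) :
    permCoords σ y i = y (σ.symm i) := by
  simp [permCoords, LinearIsometryEquiv.piLpCongrLeft_apply, Equiv.piCongrLeft'_apply]

/-- **A boundary slice chart from a local diffeomorphism and a linear change of coordinates**:
if `Θ₀` is an `ℝᵏ⁺²`-valued local diffeomorphism of `M` and `L` a linear automorphism of
`ℝᵏ⁺²` such that `S` is the half-slice `{(L Θ₀ q)_{k+1} = 0, 0 ≤ (L Θ₀ q)₀}` on the source,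
then `L ∘ Θ₀` is a boundary slice chart. [cite: LeeSmoothManifolds2013, Thm. 5.51] -/
def BoundarySliceChart.ofEquiv (Θ₀ : OpenPartialHomeomorph M (𝔼 (k + 2)))
    (h₁ : ContMDiffOn (𝓡 (k + 2)) (𝓡 (k + 2)) ∞ Θ₀ Θ₀.source)
    (h₂ : ContMDiffOn (𝓡 (k + 2)) (𝓡 (k + 2)) ∞ Θ₀.symm Θ₀.target)
    (L : (𝔼 (k + 2)) ≃L[ℝ] 𝔼 (k + 2))
    (hmem : ∀ q ∈ Θ₀.source, q ∈ S ↔ L (Θ₀ q) (Fin.last (k + 1)) = 0 ∧ 0 ≤ L (Θ₀ q) 0) :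
    BoundarySliceChart k S where
  Θ := Θ₀.transHomeomorph L.toHomeomorph
  contMDiffOn_toFun := by
    rw [OpenPartialHomeomorph.transHomeomorph_source, OpenPartialHomeomorph.transHomeomorph_apply]
    exact (contMDiff_iff_contDiff.2 L.contDiff).comp_contMDiffOn h₁
  contMDiffOn_symm := by
    rw [OpenPartialHomeomorph.transHomeomorph_target, OpenPartialHomeomorph.transHomeomorph_symm_apply]
    exact h₂.comp (contMDiff_iff_contDiff.2 L.symm.contDiff).contMDiffOn fun y hy => hy
  mem_iff q hq := by
    rw [OpenPartialHomeomorph.transHomeomorph_source] at hq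
    rw [OpenPartialHomeomorph.transHomeomorph_apply]
    exact hmem q hq

/-- The chart of `ofEquiv`, as a function. [folklore] -/
@[simp]
theorem BoundarySliceChart.ofEquiv_apply (Θ₀ : OpenPartialHomeomorph M (𝔼 (k + 2)))
    (h₁ : ContMDiffOn (𝓡 (k + 2)) (𝓡 (k + 2)) ∞ Θ₀ Θ₀.source)
    (h₂ : ContMDiffOn (𝓡 (k + 2)) (𝓡 (k + 2)) ∞ Θ₀.symm Θ₀.target)
    (L : (𝔼 (k + 2)) ≃L[ℝ] 𝔼 (k + 2))
    (hmem : ∀ q ∈ Θ₀.source, q ∈ S ↔ L (Θ₀ q) (Fin.last (k + 1)) = 0 ∧ 0 ≤ L (Θ₀ q) 0) (q : M) :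
    (BoundarySliceChart.ofEquiv Θ₀ h₁ h₂ L hmem).Θ q = L (Θ₀ q) := by
  show (Θ₀.transHomeomorph L.toHomeomorph) q = L (Θ₀ q)
  rw [OpenPartialHomeomorph.transHomeomorph_apply]; rfl

/-- The source of the chart of `ofEquiv`. [folklore] -/
@[simp]
theorem BoundarySliceChart.ofEquiv_source (Θ₀ : OpenPartialHomeomorph M (𝔼 (k + 2)))
    (h₁ : ContMDiffOn (𝓡 (k + 2)) (𝓡 (k + 2)) ∞ Θ₀ Θ₀.source)
    (h₂ : ContMDiffOn (𝓡 (k + 2)) (𝓡 (k + 2)) ∞ Θ₀.symm Θ₀.target)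
    (L : (𝔼 (k + 2)) ≃L[ℝ] 𝔼 (k + 2))
    (hmem : ∀ q ∈ Θ₀.source, q ∈ S ↔ L (Θ₀ q) (Fin.last (k + 1)) = 0 ∧ 0 ≤ L (Θ₀ q) 0) :
    (BoundarySliceChart.ofEquiv Θ₀ h₁ h₂ L hmem).Θ.source = Θ₀.source :=
  OpenPartialHomeomorph.transHomeomorph_source _ _

variable [IsManifold (𝓡 (k + 2)) ∞ M]

/-- **Interior slice charts from a regular function**: if `f` is smooth and not critical at
`p`, and on an open `O ∋ p` the set `S` is the level `{f = f p}`, then `S` has a boundary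
slice chart about `p` with source in `O` and positive `0`-th coordinate (straighten `f` by the
inverse function theorem, `exists_sliceChart`, restrict to `O`, `ofInteriorSlice`).
[cite: LeeSmoothManifolds2013, Thm. 5.51 and Cor. 5.14] -/
theorem exists_boundarySliceChart_of_not_isMCriticalPt {f : M → ℝ}
    (hf : ContMDiff (𝓡 (k + 2)) 𝓘(ℝ, ℝ) ∞ f) {p : M} (hp : ¬ IsMCriticalPt (𝓡 (k + 2)) f p)
    {O : Set M} (hO : IsOpen O) (hpO : p ∈ O) (hS : ∀ q ∈ O, q ∈ S ↔ f q = f p) :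
    ∃ D : BoundarySliceChart k S, p ∈ D.Θ.source ∧ D.Θ.source ⊆ O ∧ ∀ q ∈ D.Θ.source, 0 < D.Θ q 0 := by
  obtain ⟨ψ, hψ, hpψ, hlast, -⟩ := exists_sliceChart (I := 𝓡 (k + 2)) hf
    (BoundarylessManifold.isInteriorPoint (I := 𝓡 (k + 2))) hp
  set ψ' := ψ.restr O with hψ'def
  have hψ' : ψ' ∈ IsManifold.maximalAtlas (𝓡 (k + 2)) ∞ M :=
    restr_mem_maximalAtlas (contDiffGroupoid ∞ (𝓡 (k + 2))) hψ hO
  have hsrc : ψ'.source = ψ.source ∩ O := by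
    rw [hψ'def, OpenPartialHomeomorph.restr_source, hO.interior_eq]
  have hmem : ∀ q ∈ ψ'.source, q ∈ S ↔ ψ' q (Fin.last (k + 1)) = 0 := by
    intro q hq
    rw [hsrc] at hq
    have h1 : ψ q (Fin.last (k + 1)) = f q - f p := by
      simpa only [modelWithCornersSelf_coe, id_eq] using hlast q hq.1
    rw [hS q hq.2, hψ'def, OpenPartialHomeomorph.restr_apply, h1, sub_eq_zero]
  refine ⟨BoundarySliceChart.ofInteriorSlice ψ' hψ' p hmem,
    BoundarySliceChart.mem_ofInteriorSlice_source hψ' hmem (by rw [hsrc]; exact ⟨hpψ, hpO⟩),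
    fun q hq => ?_, fun q hq => BoundarySliceChart.ofInteriorSlice_apply_zero_pos hψ' hmem hq⟩
  have := BoundarySliceChart.ofInteriorSlice_source_subset hψ' hmem hq
  rw [hsrc] at this
  exact this.2

end Constructors

end BSlice

end Literature.Topology.FourManifolds

end
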